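import Summits.RiemannHypothesis.RiemannHypothesis.Theorems.SignConeExactConeRigidityTorus
import Summits.RiemannHypothesis.RiemannHypothesis.Theorems.SignConeExactConeRigidityCara
import Summits.RiemannHypothesis.RiemannHypothesis.Theorems.SignConeConeMagnificationStubPdLaplace

/-!
# Route SignCone, item `ExactConeRigidity` (stmt-RiemannHypothesis-16306): the item from ζ-FREE cores

With the tight Carathéodory description of exact weights (`exactWeight_cara`, `κ = 0`) and 16303's landed
`stub_cara` / `stub_pdLaplace` (`κ = 1`), every remaining hypothesis of the exact chain is a statement about ONE
nonnegative sequence `c` and ONE holomorphic function on `Re s > 1/2` — no Weil test, no zero of `ζ`, no `Λ` except as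
the comparison sequence in the conclusion.  Three closing forms, each a 3-line composition BY NAME:

* `ExactConeRigidity_of_torusOfCara` — hypothesis = the registered open core `stub_torusOfCara` of crux 16303
  VERBATIM (Carathéodory majorant with slack `1/2` ⇒ torus inequality `≤ 1/2`): the moment that stub lands, this item
  closes (`ExactConeRigidity_of_torusIneq` ∘ `stub_cara` ∘ `stub_pdLaplace`).
* `ExactConeRigidity_of_exactTorusOfCara` — the slack-`0` analogue proper to this item: TIGHT majorant
  (`Re F ≤ Re 1/s + 𝒜 − ½log π`) ⇒ torus inequality `≤ 0` (which at singletons pins `c(p) = log p`,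
  `sum_powerset_singleton_torus`).
* `ExactConeRigidity_of_primeDominationOfCara` — the weakest-looking form: TIGHT majorant ⇒ `log p ≤ c(p)` for all
  primes off a finite set (then Landau: `ExactConeRigidity_of_primeDomination`).

None of the three cores is proved here (they are the arithmetic heart of the 2001 rigidity/magnification theorems,
unpublished); this file only certifies that each of them closes stmt-16306.
-/

noncomputable section

-- `Summit.RiemannHypothesis.RiemannHypothesis.…` repeats a namespace component by design (D-0017 layout).
set_option linter.dupNamespace false

open scoped BigOperators ComplexConjugate Real Topology ArithmeticFunction.vonMangoldt
open Complex MeasureTheory Set Filter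

namespace Summit.RiemannHypothesis.RiemannHypothesis.Theorems.SignConeExactConeRigidity

open Literature.NumberTheory.LFunctions
open Summit.RiemannHypothesis.RiemannHypothesis.Theorems.SignCone
open Summit.RiemannHypothesis.RiemannHypothesis.Theorems.SignConeConeMagnification
open Summit.RiemannHypothesis.RiemannHypothesis.Cruxes.ConeMagnification.Sketch

/-- **`ExactConeRigidity` from crux 16303's registered open core `stub_torusOfCara`, verbatim.**  If for every
`c ≥ 0`, `c 1 = 0`, `Σ c(n) n^{-σ} < ∞` (`σ > 1`), every holomorphic `F` on `Re s > 1/2` continuing `L_c − 1/(s−1)` with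
`Re F(s) ≤ 1/2 + Re(1/s) + 𝒜(s) − ½log π` forces the torus inequality
`Σ_{A ⊆ S} (c(n_A) − Λ(n_A)) n_A^{-1/2} 2^{-|A|} cos(|A|φ) ≤ 1/2` for all finite sets `S` of primes and phases `φ`, then
the route item holds (`ExactConeRigidity_of_torusIneq` with the landed `stub_cara` and `stub_pdLaplace`). -/
theorem ExactConeRigidity_of_torusOfCara
    (htoc : ∀ c : ℕ → ℝ, (∀ n, 0 ≤ c n) → c 1 = 0 →
      (∀ σ : ℝ, 1 < σ → LSeriesSummable (fun n => ((c n : ℝ) : ℂ)) σ) →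
      (∃ F : ℂ → ℂ, DifferentiableOn ℂ F {s : ℂ | 1 / 2 < s.re} ∧
        (∀ s : ℂ, 1 < s.re → F s = LSeries (fun n => ((c n : ℝ) : ℂ)) s - 1 / (s - 1)) ∧
        ∀ s : ℂ, 1 / 2 < s.re →
          (F s).re ≤ 1 / 2 + (1 / s).re +
            1 / (2 * Real.pi) * (∫ v : ℝ, (Complex.digamma (1 / 4 + v / 2 * Complex.I)).re *
              ((s.re - 1 / 2) / ((s.re - 1 / 2) ^ 2 + (s.im - v) ^ 2))) - Real.log Real.pi / 2) →
      ∀ S : Finset ℕ, (∀ p ∈ S, p.Prime) → ∀ φ : ℝ,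
        ∑ A ∈ S.powerset, (c (∏ p ∈ A, p) - ArithmeticFunction.vonMangoldt (∏ p ∈ A, p)) /
            Real.sqrt (∏ p ∈ A, (p : ℝ)) * (1 / 2) ^ A.card * Real.cos ((A.card : ℝ) * φ) ≤ 1 / 2) :
    Theses.SignCone.ExactConeRigidity :=
  ExactConeRigidity_of_torusIneq fun c hc hc1 hU hsum hcont =>
    htoc c hc hc1 hsum (stub_cara c hc hc1 hU hsum hcont (stub_pdLaplace c hc hU))

/-- **`ExactConeRigidity` from the slack-`0` torus core.**  If for every `c ≥ 0`, `c 1 = 0`, `Σ c(n) n^{-σ} < ∞`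
(`σ > 1`), a holomorphic `F` on `Re s > 1/2` continuing `L_c − 1/(s−1)` with the TIGHT majorant
`Re F(s) ≤ Re(1/s) + 𝒜(s) − ½log π` forces `Σ_{A ⊆ S} (c(n_A) − Λ(n_A)) n_A^{-1/2} 2^{-|A|} cos(|A|φ) ≤ 0` for all finite
sets `S` of primes and all `φ`, then the route item holds (`exactWeight_cara`, `ExactConeRigidity_of_exactTorusIneq`). -/
theorem ExactConeRigidity_of_exactTorusOfCara
    (htoc : ∀ c : ℕ → ℝ, (∀ n, 0 ≤ c n) → c 1 = 0 →
      (∀ σ : ℝ, 1 < σ → LSeriesSummable (fun n => ((c n : ℝ) : ℂ)) σ) →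
      (∃ F : ℂ → ℂ, DifferentiableOn ℂ F {s : ℂ | 1 / 2 < s.re} ∧
        (∀ s : ℂ, 1 < s.re → F s = LSeries (fun n => ((c n : ℝ) : ℂ)) s - 1 / (s - 1)) ∧
        ∀ s : ℂ, 1 / 2 < s.re →
          (F s).re ≤ (1 / s).re +
            1 / (2 * Real.pi) * (∫ v : ℝ, (Complex.digamma (1 / 4 + v / 2 * Complex.I)).re *
              ((s.re - 1 / 2) / ((s.re - 1 / 2) ^ 2 + (s.im - v) ^ 2))) - Real.log Real.pi / 2) →
      ∀ S : Finset ℕ, (∀ p ∈ S, p.Prime) → ∀ φ : ℝ,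
        ∑ A ∈ S.powerset, (c (∏ p ∈ A, p) - ArithmeticFunction.vonMangoldt (∏ p ∈ A, p)) /
            Real.sqrt (∏ p ∈ A, (p : ℝ)) * (1 / 2) ^ A.card * Real.cos ((A.card : ℝ) * φ) ≤ 0) :
    Theses.SignCone.ExactConeRigidity :=
  ExactConeRigidity_of_exactTorusIneq fun c hc hc1 hU0 hsum _ =>
    htoc c hc hc1 hsum (exactWeight_cara hU0 hc hc1)

/-- **`ExactConeRigidity` from prime domination of tight Carathéodory weights.**  If for every `c ≥ 0`, `c 1 = 0`,
`Σ c(n) n^{-σ} < ∞` (`σ > 1`), a holomorphic `F` on `Re s > 1/2` continuing `L_c − 1/(s−1)` with the TIGHT majorant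
`Re F(s) ≤ Re(1/s) + 𝒜(s) − ½log π` forces `log p ≤ c(p)` for all primes `p` off some finite set, then the route item
holds (`exactWeight_cara`, `ExactConeRigidity_of_primeDomination`; implied by the torus core at singletons). -/
theorem ExactConeRigidity_of_primeDominationOfCara
    (hP : ∀ c : ℕ → ℝ, (∀ n, 0 ≤ c n) → c 1 = 0 →
      (∀ σ : ℝ, 1 < σ → LSeriesSummable (fun n => ((c n : ℝ) : ℂ)) σ) →
      (∃ F : ℂ → ℂ, DifferentiableOn ℂ F {s : ℂ | 1 / 2 < s.re} ∧
        (∀ s : ℂ, 1 < s.re → F s = LSeries (fun n => ((c n : ℝ) : ℂ)) s - 1 / (s - 1)) ∧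
        ∀ s : ℂ, 1 / 2 < s.re →
          (F s).re ≤ (1 / s).re +
            1 / (2 * Real.pi) * (∫ v : ℝ, (Complex.digamma (1 / 4 + v / 2 * Complex.I)).re *
              ((s.re - 1 / 2) / ((s.re - 1 / 2) ^ 2 + (s.im - v) ^ 2))) - Real.log Real.pi / 2) →
      ∃ S : Finset ℕ, ∀ p : ℕ, p.Prime → p ∉ S → Real.log p ≤ c p) :
    Theses.SignCone.ExactConeRigidity :=
  ExactConeRigidity_of_primeDomination fun c hc hc1 hU0 hsum _ =>
    hP c hc hc1 hsum (exactWeight_cara hU0 hc hc1)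

end Summit.RiemannHypothesis.RiemannHypothesis.Theorems.SignConeExactConeRigidity

end
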